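import Literature.AlgebraicGeometry.Resolution.PointBlowupShadeCentres
import Literature.AlgebraicGeometry.Resolution.PointBlowupResidueInequality
import HarnessLib

/-!
# The layer formula for the shade after a point blow-up (cell pub-rosobs, carver g16) — part 1: statements and CLAIM 1

STATUS. Summits-side file of the cell topic `KangarooAtlas` (new work of the cell `pub-rosobs`, layer carver-g16; staged in the
cell's HOME as `pub-rosobs-carver-g16/lean-staged/PointBlowupLayerFormula.lean` until the topic was registered, then filed in two
parts for the 400-line module limit: this file = the definitions, the three `…Claim` predicates and the proof of CLAIM 1
(`layerFormulaClaim_holds`); `PointBlowupLayerFormulaLayerZero` = CLAIM 3 (`layerZeroIsCondition4Claim_holds`) and CLAIM 2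
(`kangarooCriterionClaim_holds`)). Nothing in this file is a cited result: the three `…Claim` predicates are the precise
statements which the cell's two independent engines verified numerically on 268,521 edges of the walked atlas each, with
0 mismatches (CLAIMS-g16 C-g16-21; files `pub-rosobs-carver-g16/layers-walk/`, `oddkept/LAYERS-WALK-*`), and which are then
PROVED here (CLAIMS-g16 C-g16-23): elementary bookkeeping of `PointBlowup.step`.

CONTENT. For a state `s = (F, r)` of the point-blow-up walk (`Literature.…PointBlowup.State`), a chart
`y_j` and a point `b` with `b_j = 0`, write `F = Σ_d F_{N+d}` in homogeneous components, `N = ord₀ F`.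
Because the translation `y_i ↦ y_i + b_i` of the chart transform does not change the `y_j`-exponent
`N + d − q` of the monomials coming from the layer `F_{N+d}`, monomials of different layers never
interact — neither in the translation nor in the deletion of `q`-th-power monomials — so the shade of
`step q j b s` is a minimum over layers:

  `shade (step q j b s) = min_d ( d + ord_{y_i, i ≠ j} (deletePthPowers q (translate b (chartTransform q j F_{N+d}))) − Σ_{i kept} r_i )`

where "kept" = the complement of `PointBlowup.lostComponents j b`. The layer-0 inequality
`L_0 ≥ shade s + 1` is Hauser's / Hauser–Perlega's condition (4) (`HauserPerlega2019.Condition4`);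
the walk's kangaroo points are exactly the edges with `L_d ≥ shade s + 1` for EVERY `d`. Hauser–Perlega
themselves note (PRIMS 2019, §3 Comment (a)) that their theorem "does not make any statement about the higher
order terms"; the layers `d ≥ 1` are those terms in this model.
-/

open MvPolynomial Finset
open scoped BigOperators

namespace Summit.ResolutionOfSingularities.KangarooAtlas.PointBlowup

open Literature.AlgebraicGeometry.Resolution
open Literature.AlgebraicGeometry.Resolution.Hauser2010
open Literature.AlgebraicGeometry.Resolution.PointBlowup

variable {σ : Type*} {K : Type*} [Field K] [Fintype σ] [DecidableEq σ] [DecidableEq K]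

/-- The `d`-th LAYER of the step: the homogeneous component of degree `ord₀ F + d` of `F`, pushed through
the chart transform of `y_j`, the translation to the point `b`, and the deletion of `q`-th-power monomials
(the three operations of `PointBlowup.step`, applied to one layer). -/
noncomputable def layerTransform (q : ℕ) (j : σ) (b : σ → K) (s : State σ K) (d : ℕ) :
    MvPolynomial σ K :=
  deletePthPowers q (translate b (chartTransform q j (homogeneousComponent ((ordZero s.F).toNat + d) s.F)))

/-- Total multiplicity of the KEPT exceptional components (those whose strict transform passes through
the point: `i ≠ j`, `b_i = 0`). -/
def keptDegree (j : σ) (b : σ → K) (s : State σ K) : ℕ :=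
  ∑ i ∈ (lostComponents j b)ᶜ, s.r i

/-- The LAYER VALUE `L_d = d + (ord_{y_i, i ≠ j} (layer d after the step) − Σ_kept r_i)` in `ℕ∞`
(`⊤` when the layer is killed by the deletion of `q`-th powers or is absent). -/
noncomputable def layerValue (q : ℕ) (j : σ) (b : σ → K) (s : State σ K) (d : ℕ) : ℕ∞ :=
  (d : ℕ∞) + (orderAwayFrom j (layerTransform q j b s d) - (keptDegree j b s : ℕ∞))

/-- THE LAYER FORMULA (as a predicate on an edge of the walk). -/
def LayerFormula (q : ℕ) (j : σ) (b : σ → K) (s : State σ K) : Prop :=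
  (step q j b s).shade = ⨅ d : ℕ, layerValue q j b s d

/-- CLAIM 1 (checked numerically, unproved here): the layer formula holds at every edge of the walk —
hypotheses as in `PointBlowup.condition4_of_shadeIncreases` (`b_j = 0`, `F ≠ 0`, `q ≤ ord₀ F`,
`y^r ∣` every monomial). -/
def LayerFormulaClaim (q : ℕ) (j : σ) (b : σ → K) (s : State σ K) : Prop :=
  b j = 0 → s.F ≠ 0 → (q : ℕ∞) ≤ ordZero s.F → (∀ d ∈ s.F.support, s.r ≤ d) → LayerFormula q j b s

/-- ALL LAYERS OBLIQUE: every layer value is at least `shade s + 1`. -/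
def AllLayersOblique (q : ℕ) (j : σ) (b : σ → K) (s : State σ K) : Prop :=
  ∀ d : ℕ, s.shade + 1 ≤ layerValue q j b s d

/-- CLAIM 2 (checked numerically, unproved here): under the same hypotheses the shade increases at the
point (`PointBlowup.ShadeIncreases`, the kangaroo event of the walk) IFF all layers are oblique. The
printed necessary condition (4) is the case `d = 0`. -/
def KangarooCriterionClaim (q : ℕ) (j : σ) (b : σ → K) (s : State σ K) : Prop :=
  b j = 0 → s.F ≠ 0 → (q : ℕ∞) ≤ ordZero s.F → (∀ d ∈ s.F.support, s.r ≤ d) →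
    (ShadeIncreases q j b s ↔ AllLayersOblique q j b s)

/-- CLAIM 3 (bookkeeping, unproved here): the layer-0 inequality is `HauserPerlega2019.Condition4`
(the shear `y_i ↦ y_i + b_i y_j` of the initial form and the translate-after-chart of the same form have
the same exponents away from `y_j`). -/
def LayerZeroIsCondition4Claim (q : ℕ) (j : σ) (b : σ → K) (s : State σ K) : Prop :=
  b j = 0 → s.F ≠ 0 → (q : ℕ∞) ≤ ordZero s.F → (∀ d ∈ s.F.support, s.r ≤ d) →
    (s.shade + 1 ≤ layerValue q j b s 0 ↔ HauserPerlega2019.Condition4 q j b s)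


/-! ### Proof of the layer formula (CLAIM 1) — elementary bookkeeping of `PointBlowup.step`

The `n`-th LAYER STATE `(F_n, r)` (`F_n` the homogeneous component of degree `n` of `F`) is stepped
by the same `PointBlowup.step`; the residual polynomial of the stepped layer state `o + d` is the
`d`-th layer transform, and the monomials `y^E` of the stepped state `step q j b s` with `E_j = n − q`
are exactly the monomials of the stepped layer state `n` (the translation fixes `y_j` since `b_j = 0`,
the deletion of `q`-th powers is coefficientwise). -/

section LayerProof

/-- The `n`-th layer state: the degree-`n` homogeneous component of `F` with the same multiplicities. -/
noncomputable abbrev layerState (n : ℕ) (s : State σ K) : State σ K := ⟨homogeneousComponent n s.F, s.r⟩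

omit [Fintype σ] [DecidableEq σ] [DecidableEq K] in
/-- Support of a homogeneous component: the monomials of `F` of degree `n`. -/
theorem mem_support_homogeneousComponent_iff (n : ℕ) (F : MvPolynomial σ K) (d : σ →₀ ℕ) :
    d ∈ (homogeneousComponent n F).support ↔ d ∈ F.support ∧ d.degree = n := by
  rw [MvPolynomial.mem_support_iff, MvPolynomial.mem_support_iff, coeff_homogeneousComponent]
  by_cases h : d.degree = n <;> simp [h]

omit [Fintype σ] [DecidableEq σ] [DecidableEq K] in
/-- Below the order there is no layer. -/
theorem homogeneousComponent_eq_zero_of_lt (s : State σ K) {o : ℕ} (ho : ordZero s.F = o) {n : ℕ}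
    (hn : n < o) : homogeneousComponent n s.F = 0 := by
  ext d
  rw [coeff_homogeneousComponent, coeff_zero]
  split_ifs with h
  · obtain ⟨-, hmin⟩ := (ordZero_eq_nat_iff _ _).mp ho
    exact hmin d (h ▸ hn)
  · rfl

omit [Fintype σ] in
/-- The layer transform of the file header is the residual polynomial of the stepped layer state. -/
theorem layerTransform_eq (q : ℕ) (j : σ) (b : σ → K) (s : State σ K) {o : ℕ} (ho : ordZero s.F = o)
    (d : ℕ) : layerTransform q j b s d = (step q j b (layerState (o + d) s)).F := by
  unfold layerTransform
  rw [ho, ENat.toNat_coe]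
  rfl

omit [Fintype σ] in
/-- Below the order the stepped layer state is zero. -/
theorem step_layerState_F_eq_zero_of_lt (q : ℕ) (j : σ) (b : σ → K) (s : State σ K) {o : ℕ}
    (ho : ordZero s.F = o) {n : ℕ} (hn : n < o) : (step q j b (layerState n s)).F = 0 := by
  show deletePthPowers q (translate b (chartTransform q j (homogeneousComponent n s.F))) = 0
  rw [homogeneousComponent_eq_zero_of_lt s ho hn]
  unfold chartTransform translate
  rw [MvPolynomial.support_zero, Finset.sum_empty, map_zero, deletePthPowers_zero]

omit [DecidableEq K] in
/-- **Layers do not interact (translation).** The coefficient of `y^E` in the translated chart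
transform of `F` is its coefficient in the translated chart transform of the layer `F_{E_j + q}`:
a monomial `y^d` of `F` (degree `≥ o ≥ q`) is sent by the chart transform to `y_j`-exponent
`|d| − q`, which the translation by `b` (`b_j = 0`) preserves. -/
theorem coeff_pointTransform_eq_layer (q : ℕ) (j : σ) (b : σ → K) (hbj : b j = 0) (s : State σ K)
    {o : ℕ} (ho : ordZero s.F = o) (hqo : q ≤ o) (E : σ →₀ ℕ) :
    coeff E (pointTransform q j b s) = coeff E (pointTransform q j b (layerState (E j + q) s)) := by
  classical
  have hdeg := le_degree_of_ordZero_eq s ho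
  rw [pointTransform_eq_sum, pointTransform_eq_sum, coeff_sum, coeff_sum]
  have hrhs : ∀ d ∈ (homogeneousComponent (E j + q) s.F).support,
      coeff E (translate b (monomial (chartExponent q j d) (coeff d (homogeneousComponent (E j + q) s.F)))) =
        coeff E (translate b (monomial (chartExponent q j d) (coeff d s.F))) := by
    intro d hd
    rw [coeff_homogeneousComponent, if_pos ((mem_support_homogeneousComponent_iff _ _ d).mp hd).2]
  show ∑ d ∈ s.F.support, coeff E (translate b (monomial (chartExponent q j d) (coeff d s.F))) =
    ∑ d ∈ (homogeneousComponent (E j + q) s.F).support,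
      coeff E (translate b (monomial (chartExponent q j d) (coeff d (homogeneousComponent (E j + q) s.F))))
  rw [Finset.sum_congr rfl hrhs]
  symm
  apply Finset.sum_subset
  · intro d hd
    exact ((mem_support_homogeneousComponent_iff _ _ d).mp hd).1
  · intro d hd hnd
    by_contra hne
    have h1 := apply_eq_of_coeff_translate_monomial_ne_zero b hbj hne
    rw [chartExponent_apply, if_pos rfl] at h1
    have h2 := hdeg d hd
    apply hnd
    rw [mem_support_homogeneousComponent_iff]
    exact ⟨hd, by omega⟩

/-- **Layers do not interact (cleaning).** The same for the residual polynomial after the deletion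
of the `q`-th power monomials (which is coefficientwise). -/
theorem coeff_step_eq_layer (q : ℕ) (j : σ) (b : σ → K) (hbj : b j = 0) (s : State σ K)
    {o : ℕ} (ho : ordZero s.F = o) (hqo : q ≤ o) (E : σ →₀ ℕ) :
    coeff E (step q j b s).F = coeff E (step q j b (layerState (E j + q) s)).F := by
  show coeff E (deletePthPowers q (pointTransform q j b s)) =
    coeff E (deletePthPowers q (pointTransform q j b (layerState (E j + q) s)))
  rw [coeff_deletePthPowers, coeff_deletePthPowers, coeff_pointTransform_eq_layer q j b hbj s ho hqo E]

/-- The monomials of the stepped state are the monomials of the stepped layer states. -/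
theorem mem_support_step_iff_layer (q : ℕ) (j : σ) (b : σ → K) (hbj : b j = 0) (s : State σ K)
    {o : ℕ} (ho : ordZero s.F = o) (hqo : q ≤ o) (E : σ →₀ ℕ) :
    E ∈ (step q j b s).F.support ↔ E ∈ (step q j b (layerState (E j + q) s)).F.support := by
  rw [MvPolynomial.mem_support_iff, MvPolynomial.mem_support_iff, coeff_step_eq_layer q j b hbj s ho hqo E]

/-- Every monomial of the stepped layer state `n` has `y_j`-exponent `n − q`. -/
theorem apply_eq_of_mem_support_step_layerState (q : ℕ) (j : σ) (b : σ → K) (hbj : b j = 0)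
    (s : State σ K) (n : ℕ) {E : σ →₀ ℕ} (hE : E ∈ (step q j b (layerState n s)).F.support) :
    E j = n - q := by
  classical
  have h : coeff E (pointTransform q j b (layerState n s)) ≠ 0 := by
    have h0 := MvPolynomial.mem_support_iff.mp hE
    change coeff E (deletePthPowers q (pointTransform q j b (layerState n s))) ≠ 0 at h0
    rw [coeff_deletePthPowers] at h0
    split_ifs at h0 with hP
    · exact (h0 rfl).elim
    · exact h0
  rw [pointTransform_eq_sum, coeff_sum] at h
  obtain ⟨d, hd, hne⟩ := Finset.exists_ne_zero_of_sum_ne_zero h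
  have h1 := apply_eq_of_coeff_translate_monomial_ne_zero b hbj hne
  rw [chartExponent_apply, if_pos rfl] at h1
  rw [h1, ((mem_support_homogeneousComponent_iff n s.F d).mp hd).2]

/-- The layer index of a monomial of the stepped state is at least the order: `E_j + q ≥ o`. -/
theorem le_apply_add_of_mem_support_step (q : ℕ) (j : σ) (b : σ → K) (hbj : b j = 0) (s : State σ K)
    {o : ℕ} (ho : ordZero s.F = o) (hqo : q ≤ o) {E : σ →₀ ℕ} (hE : E ∈ (step q j b s).F.support) :
    o ≤ E j + q := by
  by_contra hlt
  rw [not_le] at hlt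
  rw [mem_support_step_iff_layer q j b hbj s ho hqo E, step_layerState_F_eq_zero_of_lt q j b s ho hlt,
    MvPolynomial.support_zero] at hE
  exact Finset.notMem_empty E hE

/-- **The kept components divide every monomial after the step**: `Σ_{i kept} r_i ≤ |E| − E_j`
for every monomial `y^E` of the stepped state. -/
theorem keptDegree_le_of_mem_support_step (q : ℕ) (j : σ) (b : σ → K) (hbj : b j = 0)
    (s : State σ K) {o : ℕ} (ho : ordZero s.F = o) (hr : ∀ d ∈ s.F.support, s.r ≤ d)
    {E : σ →₀ ℕ} (hE : E ∈ (step q j b s).F.support) : keptDegree j b s ≤ E.degree - E j := by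
  classical
  have hle := newMult_le_of_mem_support_step q j b hbj s ho hr E hE
  change newMult q j b s ≤ E at hle
  rw [newMult_eq q j b hbj s ho] at hle
  unfold keptDegree
  have hsub : (lostComponents j b)ᶜ ⊆ univ.erase j := by
    intro i hi
    simp only [lostComponents, Finset.mem_compl, Finset.mem_filter, Finset.mem_univ, true_and,
      not_or, not_not] at hi
    exact Finset.mem_erase.mpr ⟨hi.1, Finset.mem_univ i⟩
  have hdegE := degree_eq_add_sum_erase j E
  calc ∑ i ∈ (lostComponents j b)ᶜ, s.r i ≤ ∑ i ∈ (lostComponents j b)ᶜ, E i := by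
        refine Finset.sum_le_sum fun i hi => ?_
        simp only [lostComponents, Finset.mem_compl, Finset.mem_filter, Finset.mem_univ, true_and,
          not_or, not_not] at hi
        have h1 := Finsupp.le_def.mp hle i
        rw [Finsupp.filter_apply, if_pos hi.2, Finsupp.update_apply, if_neg hi.1] at h1
        exact h1
    _ ≤ ∑ i ∈ univ.erase j, E i :=
        Finset.sum_le_sum_of_subset_of_nonneg hsub fun _ _ _ => Nat.zero_le _
    _ = E.degree - E j := by omega

/-- The new exceptional multiplicities have total degree `(o − q) + Σ_{i kept} r_i`. -/
theorem degree_step_r_eq (q : ℕ) (j : σ) (b : σ → K) (hbj : b j = 0) (s : State σ K) {o : ℕ}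
    (ho : ordZero s.F = o) : (step q j b s).r.degree = (o - q) + keptDegree j b s := by
  have h1 := degree_newMult_add_sum_lost q j b hbj s ho
  have h2 : s.r.degree = ∑ i ∈ lostComponents j b, s.r i + ∑ i ∈ (lostComponents j b)ᶜ, s.r i := by
    rw [Finsupp.degree_eq_sum, Finset.sum_add_sum_compl]
  change (newMult q j b s).degree = _
  unfold keptDegree
  omega

/-- **(I) Every layer bounds the new shade:** `shade (step q j b s) ≤ L_d`. -/
theorem shade_step_le_layerValue (q : ℕ) (j : σ) (b : σ → K) (hbj : b j = 0) (s : State σ K)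
    {o : ℕ} (ho : ordZero s.F = o) (hqo : q ≤ o) (hr : ∀ d ∈ s.F.support, s.r ≤ d) (d : ℕ) :
    (step q j b s).shade ≤ layerValue q j b s d := by
  classical
  unfold layerValue
  rw [layerTransform_eq q j b s ho d]
  by_cases h0 : (step q j b (layerState (o + d) s)).F = 0
  · rw [h0, orderAwayFrom_zero, ENat.top_sub_coe, add_top]
    exact le_top
  have hne : (step q j b (layerState (o + d) s)).F.support.Nonempty := by
    rw [Finset.nonempty_iff_ne_empty, Ne, MvPolynomial.support_eq_empty]
    exact h0
  obtain ⟨E, hE, hEq⟩ := Finset.exists_mem_eq_inf _ hne (fun e : σ →₀ ℕ => ((e.degree - e j : ℕ) : ℕ∞))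
  unfold orderAwayFrom
  rw [hEq]
  have hEj : E j = o + d - q := apply_eq_of_mem_support_step_layerState q j b hbj s (o + d) hE
  have hidx : E j + q = o + d := by omega
  have hE' : E ∈ (step q j b s).F.support := by
    rw [mem_support_step_iff_layer q j b hbj s ho hqo E, hidx]
    exact hE
  have hkept := keptDegree_le_of_mem_support_step q j b hbj s ho hr hE'
  have hr' := degree_step_r_eq q j b hbj s ho
  have hdegE := degree_eq_add_sum_erase j E
  rw [← ENat.coe_sub, ← Nat.cast_add]
  exact shade_le_of_mem_support (step q j b s) hE' (m := d + (E.degree - E j - keptDegree j b s))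
    (by omega)

/-- **(II) The infimum of the layer values is attained by the new shade.** -/
theorem iInf_layerValue_le_shade_step (q : ℕ) (j : σ) (b : σ → K) (hbj : b j = 0) (s : State σ K)
    {o : ℕ} (ho : ordZero s.F = o) (hqo : q ≤ o) (hr : ∀ d ∈ s.F.support, s.r ≤ d) :
    ⨅ d : ℕ, layerValue q j b s d ≤ (step q j b s).shade := by
  classical
  by_cases h0 : (step q j b s).F = 0
  · have htop : (step q j b s).shade = ⊤ := by
      unfold State.shade
      rw [h0, ordZero_zero, ENat.top_sub_coe]
    rw [htop]
    exact le_top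
  have hfin : ordZero (step q j b s).F ≠ ⊤ := by
    unfold ordZero
    rw [Ne, MvPowerSeries.order_eq_top_iff, MvPolynomial.coe_eq_zero_iff]
    exact h0
  obtain ⟨n, hn⟩ := ENat.ne_top_iff_exists.mp hfin
  have hn' : ordZero (step q j b s).F = n := hn.symm
  obtain ⟨⟨E, hE, hEdeg⟩, -⟩ := (ordZero_eq_nat_iff _ _).mp hn'
  have hEs : E ∈ (step q j b s).F.support := MvPolynomial.mem_support_iff.mpr hE
  have hoj := le_apply_add_of_mem_support_step q j b hbj s ho hqo hEs
  obtain ⟨d, hd⟩ : ∃ d, E j + q = o + d := ⟨E j + q - o, by omega⟩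
  have hE2 : E ∈ (step q j b (layerState (o + d) s)).F.support := by
    rw [← hd, ← mem_support_step_iff_layer q j b hbj s ho hqo E]
    exact hEs
  have hkept := keptDegree_le_of_mem_support_step q j b hbj s ho hr hEs
  have hr' := degree_step_r_eq q j b hbj s ho
  have hdegE := degree_eq_add_sum_erase j E
  refine (iInf_le _ d).trans ?_
  unfold layerValue
  rw [layerTransform_eq q j b s ho d, shade_eq_of_ordZero_eq (step q j b s) hn']
  have hA : orderAwayFrom j (step q j b (layerState (o + d) s)).F ≤ ((E.degree - E j : ℕ) : ℕ∞) :=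
    Finset.inf_le (f := fun e : σ →₀ ℕ => ((e.degree - e j : ℕ) : ℕ∞)) hE2
  calc (d : ℕ∞) + (orderAwayFrom j (step q j b (layerState (o + d) s)).F - (keptDegree j b s : ℕ∞))
      ≤ (d : ℕ∞) + (((E.degree - E j : ℕ) : ℕ∞) - (keptDegree j b s : ℕ∞)) :=
        add_le_add (le_refl _) (tsub_le_tsub_right hA _)
    _ = ((d + (E.degree - E j - keptDegree j b s) : ℕ) : ℕ∞) := by
        rw [← ENat.coe_sub, ← Nat.cast_add]
    _ ≤ ((n - (step q j b s).r.degree : ℕ) : ℕ∞) := by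
        exact_mod_cast (by omega)

/-- **THE LAYER FORMULA** (CLAIM 1 with the order named): `shade (step q j b s) = ⨅_d L_d`. -/
theorem layerFormula_of_ordZero_eq (q : ℕ) (j : σ) (b : σ → K) (hbj : b j = 0) (s : State σ K)
    {o : ℕ} (ho : ordZero s.F = o) (hqo : q ≤ o) (hr : ∀ d ∈ s.F.support, s.r ≤ d) :
    LayerFormula q j b s :=
  le_antisymm (le_iInf fun d => shade_step_le_layerValue q j b hbj s ho hqo hr d)
    (iInf_layerValue_le_shade_step q j b hbj s ho hqo hr)

/-- **CLAIM 1 holds.** -/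
theorem layerFormulaClaim_holds (q : ℕ) (j : σ) (b : σ → K) (s : State σ K) :
    LayerFormulaClaim q j b s := by
  intro hb hF hq hr
  have hfin : ordZero s.F ≠ ⊤ := by
    unfold ordZero
    rw [Ne, MvPowerSeries.order_eq_top_iff, MvPolynomial.coe_eq_zero_iff]
    exact hF
  obtain ⟨o, ho⟩ := ENat.ne_top_iff_exists.mp hfin
  have ho' : ordZero s.F = o := ho.symm
  have hqo : q ≤ o := by
    rw [ho'] at hq
    exact_mod_cast hq
  exact layerFormula_of_ordZero_eq q j b hb s ho' hqo hr

end LayerProof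

end Summit.ResolutionOfSingularities.KangarooAtlas.PointBlowup
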